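import Summits.AnomalousDissipation.AnomalousDissipation.Theorems.BaireTransferDenseLoudDesignerForcesErgodicLine
import Literature.Analysis.FunctionSpaces.TorusLinearisedNSForcedExistence

/-!
# Existence of the linearised flow with a source along a classical trajectory (line
# `ergodic-budget-selection-closing`, crux `BaireTransfer.DenseLoudDesignerForces`, stmt-AnomalousDissipation-1143)
# — tools stub R1 of block N-R

Sorry-free file over the landed vocabulary `…ErgodicLine.lean` and the landed existence theorem for the
INHOMOGENEOUS linearised Navier–Stokes equation on the flat torus
(`Literature/Analysis/FunctionSpaces/TorusLinearisedNSForcedExistence.lean`: `Torus.linearisedNSForced_exists`,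
the Fourier–Picard construction `Literature/Analysis/FluidPDE/LinearisedNSFourierForced*` — the homogeneous
Duhamel map of `LinearisedNSFourier*` plus the Duhamel integral of the Leray-projected source; differences of
the forced map are differences of the homogeneous map, so the contraction is untouched). Block N-R of the line
(regularity of `u₀ ↦ S_t u₀`, the `C²` theory of the NS_ν semiflow) needs, besides the derivative cocycle
(N0f, `stub_linearisedExistenceTools`), the SECOND-VARIATION equation
`∂ₜζ + (u·∇)ζ + (ζ·∇)u = νΔζ − ∇π − (w·∇)w` and every inhomogeneous linearised problem with a smooth mean-zero
source; this file supplies exactly that: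

* `stub_linearisedForcedExistenceTools` (the REGISTERED tools stub, proved) — for `ν > 0`, `a < b`, `u` jointly
  smooth on `[a, b] × T³` with divergence-free slices, `g` jointly smooth on `[a, b] × T³` with mean-zero slices,
  and a smooth divergence-free mean-zero datum `w₀`, there are `w`, `q` jointly smooth on `[a, b] × T³` with
  `w(t)` divergence free and mean zero, `∂ₜw + (u·∇)w + (w·∇)u = νΔw − ∇q + g` on `[a, b]` (one-sided time
  derivative within `[a, b]`) and `w a = w₀` (the case `d = Fin 3` of `Torus.linearisedNSForced_exists`,
  dropping its clause `∫ q(t) = 0`; uniqueness is the landed `Torus.linearisedNS_unique` applied to differences).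

References: P. Constantin, C. Foias, *Navier–Stokes Equations* (Univ. Chicago Press 1988), Ch. 14,
(14.2)–(14.6) (the linearised equation along `S(t)u₀`, its solution operator, and the second variation);
R. Temam, *Infinite-Dimensional Dynamical Systems in Mechanics and Physics*, 2nd ed. (1997), Ch. VI §3.1,
(3.7)–(3.11), §8. Nothing is asserted; no definition is added.
-/

-- `Summit.<Summit>.<Problem>` is the tree's mandated summit-side namespace (CONVENTIONS §2); for this
-- single-conjunct summit the two coincide, so the duplicate is deliberate.
set_option linter.dupNamespace false

noncomputable section

namespace Summit.AnomalousDissipation.AnomalousDissipation.Theorems.DenseLoudDesignerForces.Ergodic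

open Set Function MeasureTheory Filter
open scoped InnerProductSpace
open Literature.Analysis.FunctionSpaces Literature.Analysis.FunctionSpaces.Torus
open Literature.Analysis.FluidPDE Literature.Analysis.FluidPDE.Torus

/-- **Tools stub R1 — existence for the linearised system WITH A SMOOTH MEAN-ZERO SOURCE** (the second-variation
equation `∂ₜζ + (u·∇)ζ + (ζ·∇)u = νΔζ − ∇π − (w·∇)w`, and every inhomogeneous linearised problem of the `C²`
theory).  For `ν > 0`, `a < b`, a velocity field `u` jointly smooth on `[a, b] × T³` with divergence-free slices,
a source `g` jointly smooth on `[a, b] × T³` with mean-zero slices, and a smooth divergence-free mean-zero datum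
`w₀`, the system `∂ₜw + (u·∇)w + (w·∇)u = νΔw − ∇q + g`, `div w = 0`, `∫ w = 0` has a solution `(w, q)` jointly
smooth on `[a, b] × T³` with `w(a) = w₀`.  Same Fourier–Picard construction as N0f (`LinearisedNSFourier*`,
`Torus.linearisedNS_exists`) with the source added to the Picard map exactly as `S` in `ScalarFourier.picardMap`
(the contraction is untouched: `LinearisedNSFourierForced*`, `Torus.linearisedNSForced_exists`); the source must
have mean-zero slices for `∫ w = 0` to propagate (its divergence-free part is what acts, through `P`).
Constantin–Foias 1988 Ch. 14 (14.3) with inhomogeneity; Temam 1997 Ch. VI §8.  Proof: the tree's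
`Torus.linearisedNSForced_exists` at `d = Fin 3`, dropping the clause `∫ q(t) = 0`.
[cite: ConstantinFoiasNSE1988, Ch. 14 (14.3)–(14.4)] -/
theorem stub_linearisedForcedExistenceTools {ν : ℝ} (hν : 0 < ν) {a b : ℝ} (hab : a < b)
    {u : ℝ → (UnitAddTorus (Fin 3)) → (EuclideanSpace ℝ (Fin 3))} (hu : IsSmoothSpaceTimeOn (Icc a b) u)
    (hudiv : ∀ t ∈ Icc a b, IsDivFree (u t))
    {g : ℝ → (UnitAddTorus (Fin 3)) → (EuclideanSpace ℝ (Fin 3))} (hg : IsSmoothSpaceTimeOn (Icc a b) g)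
    (hgmean : ∀ t ∈ Icc a b, HasZeroMean (g t))
    {w₀ : (UnitAddTorus (Fin 3)) → (EuclideanSpace ℝ (Fin 3))} (hw₀ : IsSmooth w₀) (hw₀div : IsDivFree w₀)
    (hw₀mean : HasZeroMean w₀) :
    ∃ (w : ℝ → (UnitAddTorus (Fin 3)) → (EuclideanSpace ℝ (Fin 3))) (q : ℝ → (UnitAddTorus (Fin 3)) → ℝ),
      IsSmoothSpaceTimeOn (Icc a b) w ∧ IsSmoothSpaceTimeOn (Icc a b) q ∧
      (∀ t ∈ Icc a b, IsDivFree (w t)) ∧ (∀ t ∈ Icc a b, HasZeroMean (w t)) ∧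
      (∀ t ∈ Icc a b, ∀ x, Torus.timeDerivWithin (Icc a b) w t x + convect (u t) (w t) x + convect (w t) (u t) x =
        ν • laplacian (w t) x - Torus.gradient (q t) x + g t x) ∧ w a = w₀ := by
  obtain ⟨w, q, hw, hq, hdiv, hmean, -, hmom, h0⟩ :=
    Torus.linearisedNSForced_exists hν hab hu hudiv hg hgmean hw₀ hw₀div hw₀mean
  exact ⟨w, q, hw, hq, hdiv, hmean, hmom, h0⟩

end Summit.AnomalousDissipation.AnomalousDissipation.Theorems.DenseLoudDesignerForces.Ergodic

end
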